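import Summits.BirchSwinnertonDyer.Rank1Residual.Additive.DisegniLineLeadingCoeff
import Summits.BirchSwinnertonDyer.Rank1Residual.Additive.DisegniLineLeadingCoeffOdd
import Summits.BirchSwinnertonDyer.Rank1Residual.Additive.TameBranchOfTwistBranchMult
import HarnessLib

/-!
# Route `AdditiveBranchIMC` (rung K1), crux `MultLower` (item 19359), cell (M): the ONE-TERM branch package
# of the newform of a MULTIPLICATIVE curve (`α = a_p(V) = ±1`) — boundedness, interpolation at every
# character of `Γ`, constant term, and the level-`p` Legendre sums (kernel (M) twin of gz's STEP B(2), part 1)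

Cell `bsd-addord`, seat `bsd-addord-k1-c4` (gen 4). First file of the kernel (M) twin of gz's `DisegniLine*`
chain (HOME/proof/PROOF-gz-kernel.md §4 «Mult rows: not in this kernel»; item 19592's text «the KERNEL (M)
twin of gz's DisegniLine STEP A–C (α = a_p(V) = ±1) is unwritten»). THEOREMS ONLY (no definition, no named
fact, no `sorry`); wrappers over the tree's one-term Mazur–Tate–Teitelbaum measure at `p ∣ N`
(`msdPlus/MinusMeasureMult`, `padicLFunction{Plus,Minus}BranchMult`; MTT §I.10 (10.1) with `ε(p) = 0`) keyed
to a curve `V` MULTIPLICATIVE at `p` and its newform `g` (`a_p(V) = V.LFunction p = ±1`, `p ∣ N`: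
`LFunction_eq_or_eq_neg_and_dvd_level_of_mult`):

* `msdPlus/MinusMeasureMult_package_of_mult`: distribution law + bound;
* `exists_norm_coeff_padicLFunction{Plus,Minus}BranchMult_le_of_mult`: bounded branches;
* `hasSum_coeff_padicLFunction{Plus,Minus}BranchMult_mul_pow_of_mult`: interpolation at EVERY character of
  `Γ` of level `p^{m+1} ≥ p^{e₀}` (one term: no primitivity hypothesis);
* `constantCoeff_padicLFunction{Plus,Minus}BranchMult_half_of_mult`: `L^±_p(g, a_p, ω^{(p−1)/2}, 0) =
  a_p⁻¹·∑(a/p)[a/p]^±_g`;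
* `sum_one_mul_teichWeight_mul_rat{Plus,Minus}Symbol_eq`: the α-free level-`p` sum against `𝟙` is the
  Legendre symbol sum (the α-free half of gz's `branchValue_one_eq_constantCoeff`).

Consumer: `AdditiveBranchIMCMultLowerCycLineLeadingCoeff.lean` (STEP B(2) on (M), both parities).
References: [MazurTateTeitelbaum1986Invent] §I.8 (8.6), §I.10 (10.1), §I.12–I.14; [Disegni2017] Thm. A.
-/

set_option autoImplicit false
set_option linter.dupNamespace false

noncomputable section

open scoped Classical MatrixGroups ModularForm NumberField

namespace Summit.BirchSwinnertonDyer.BirchSwinnertonDyer.Theorems.AdditiveBranchIMCMultLower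

open CongruenceSubgroup WeierstrassCurve Literature.NumberTheory.EllipticCurves
  Literature.NumberTheory.EllipticCurves.ModularForms
  Literature.NumberTheory.EllipticCurves.Disegni2017
  Literature.NumberTheory.EllipticCurves.Rank1Residual
  Summit.BirchSwinnertonDyer.Rank1Residual.Additive

section Package

variable {p : ℕ} [hp : Fact p.Prime]

/-! ### §1 The one-term branches of the newform of a MULTIPLICATIVE curve: boundedness, interpolation,
constant term -/

/-- **`a_p(V) = ±1`, `p ∣ N`, `‖a_p‖_p = 1`, `a_p ≠ 0` in `ℚ_p`** for `V` multiplicative at `p` with newform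
`g` of level `N`. [cite: MazurTateTeitelbaum1986Invent, §I.10 (allowable root at p ∣ N)] -/
theorem multRoot_spec (V : WeierstrassCurve ℚ) [V.IsElliptic] [V.IsGloballyMinimal] (hV : Mult V p)
    {N : ℕ} [NeZero N] {g : CuspForm (Gamma0 N) 2} (hg : IsNewformOf V g) :
    ((V.LFunction p : ℤ) = 1 ∨ (V.LFunction p : ℤ) = -1) ∧ p ∣ N ∧
      ‖((V.LFunction p : ℤ) : ℚ_[p])‖ = 1 ∧ ((V.LFunction p : ℤ) : ℚ_[p]) ≠ 0 := by
  obtain ⟨h1, hpN⟩ := LFunction_eq_or_eq_neg_and_dvd_level_of_mult V hV hg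
  exact ⟨h1, hpN, norm_intCast_eq_one_of_eq_one_or_eq_neg_one (p := p) h1⟩

/-- **The one-term PLUS measure of the newform of a multiplicative curve is a bounded distribution**
(`α = a_p(V)`): distribution law `sum_fiber_msdPlusMeasureMult_succ_eq_of_coeffField` (the `U_p`-relation
at `p ∣ N`), bound `exists_norm_ratPlusSymbol_le` (`‖α⁻ⁿ‖ = 1`). [cite: MazurTateTeitelbaum1986Invent, §I.10 (10.1), §I.12] -/
theorem msdPlusMeasureMult_package_of_mult (V : WeierstrassCurve ℚ) [V.IsElliptic] [V.IsGloballyMinimal]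
    (hV : Mult V p) {N : ℕ} [NeZero N] {g : CuspForm (Gamma0 N) 2} (hg : IsNewformOf V g) :
    (∀ (n : ℕ) (a : ZMod (p ^ n)),
      ∑ b ∈ Finset.univ.filter (fun b : ZMod (p ^ (n + 1)) ↦
        ZMod.castHom (pow_dvd_pow p n.le_succ) (ZMod (p ^ n)) b = a),
          msdPlusMeasureMult g ((V.LFunction p : ℤ) : ℚ_[p]) (n + 1) b =
        msdPlusMeasureMult g ((V.LFunction p : ℤ) : ℚ_[p]) n a) ∧
    ∃ C : ℝ, ∀ (n : ℕ) (a : ZMod (p ^ n)), ‖msdPlusMeasureMult g ((V.LFunction p : ℤ) : ℚ_[p]) n a‖ ≤ C := by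
  obtain ⟨-, hpN, hαu, hα0⟩ := multRoot_spec V hV hg
  refine ⟨sum_fiber_msdPlusMeasureMult_succ_eq_of_coeffField (p := p) hg.1 hg.coeffField_eq_bot hpN
    (hg.2 p) hα0, ?_⟩
  obtain ⟨C, hC⟩ := exists_norm_ratPlusSymbol_le (p := p) hg.1 hg.coeffField_eq_bot
  exact ⟨C, fun n a ↦ by
    rw [msdPlusMeasureMult, norm_mul, norm_pow, norm_inv, hαu, inv_one, one_pow, one_mul]
    exact hC n a⟩

/-- **The one-term MINUS measure of the newform of a multiplicative curve is a bounded distribution**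
(distribution law `sum_fiber_msdMinusMeasureMult_succ_eq_of_coeffField`; bound from Manin–Drinfeld,
`exists_forall_norm_ratMinusSymbol_le_of_maninDrinfeld`). [cite: MazurTateTeitelbaum1986Invent, §I.10 (10.1), §I.12] -/
theorem msdMinusMeasureMult_package_of_mult (V : WeierstrassCurve ℚ) [V.IsElliptic] [V.IsGloballyMinimal]
    (hV : Mult V p) {N : ℕ} [NeZero N] {g : CuspForm (Gamma0 N) 2} (hg : IsNewformOf V g) :
    (∀ (n : ℕ) (a : ZMod (p ^ n)),
      ∑ b ∈ Finset.univ.filter (fun b : ZMod (p ^ (n + 1)) ↦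
        ZMod.castHom (pow_dvd_pow p n.le_succ) (ZMod (p ^ n)) b = a),
          msdMinusMeasureMult g ((V.LFunction p : ℤ) : ℚ_[p]) (n + 1) b =
        msdMinusMeasureMult g ((V.LFunction p : ℤ) : ℚ_[p]) n a) ∧
    ∃ C : ℝ, ∀ (n : ℕ) (a : ZMod (p ^ n)),
      ‖msdMinusMeasureMult g ((V.LFunction p : ℤ) : ℚ_[p]) n a‖ ≤ C := by
  obtain ⟨-, hpN, hαu, hα0⟩ := multRoot_spec V hV hg
  refine ⟨sum_fiber_msdMinusMeasureMult_succ_eq_of_coeffField (p := p) hg.1 hg.coeffField_eq_bot hpN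
    (hg.2 p) hα0, ?_⟩
  obtain ⟨C, -, hC⟩ := exists_forall_norm_ratMinusSymbol_le_of_maninDrinfeld (p := p)
    (exists_nsmul_modularSymbol_mem_periodLattice_of_isNewform0 hg.1 hg.coeffField_eq_bot)
  exact ⟨C, fun n a ↦ by
    rw [msdMinusMeasureMult, norm_mul, norm_pow, norm_inv, hαu, inv_one, one_pow, one_mul]
    exact hC _⟩

/-- **Boundedness of the plus branch of a multiplicative newform.** [cite: MazurTateTeitelbaum1986Invent, §I.12–I.13] -/
theorem exists_norm_coeff_padicLFunctionPlusBranchMult_le_of_mult (V : WeierstrassCurve ℚ) [V.IsElliptic]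
    [V.IsGloballyMinimal] (hV : Mult V p) {N : ℕ} [NeZero N] {g : CuspForm (Gamma0 N) 2}
    (hg : IsNewformOf V g) (i : ℕ) :
    ∃ C : ℝ, ∀ k : ℕ,
      ‖PowerSeries.coeff k (padicLFunctionPlusBranchMult g ((V.LFunction p : ℤ) : ℚ_[p]) i)‖ ≤ C := by
  obtain ⟨hdist, C, hC⟩ := msdPlusMeasureMult_package_of_mult V hV hg
  exact ⟨C, fun k ↦ norm_coeff_padicLFunctionPlusBranchMult_le g _ hdist hC i k⟩

/-- **Boundedness of the minus branch of a multiplicative newform.** [cite: MazurTateTeitelbaum1986Invent, §I.12–I.13] -/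
theorem exists_norm_coeff_padicLFunctionMinusBranchMult_le_of_mult (V : WeierstrassCurve ℚ) [V.IsElliptic]
    [V.IsGloballyMinimal] (hV : Mult V p) {N : ℕ} [NeZero N] {g : CuspForm (Gamma0 N) 2}
    (hg : IsNewformOf V g) (i : ℕ) :
    ∃ C : ℝ, ∀ k : ℕ,
      ‖PowerSeries.coeff k (padicLFunctionMinusBranchMult g ((V.LFunction p : ℤ) : ℚ_[p]) i)‖ ≤ C := by
  obtain ⟨hdist, C, hC⟩ := msdMinusMeasureMult_package_of_mult V hV hg
  exact ⟨C, fun k ↦ norm_coeff_padicLFunctionMinusBranchMult_le g _ hdist hC i k⟩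

/-- **Interpolation of the plus branch of a multiplicative newform at EVERY character of `Γ`** of level
`p^{m+1} ≥ p^{e₀}` (MTT §I.14 with `ε(p) = 0`: one term, no primitivity hypothesis).
[cite: MazurTateTeitelbaum1986Invent, §I.13–I.14] -/
theorem hasSum_coeff_padicLFunctionPlusBranchMult_mul_pow_of_mult (V : WeierstrassCurve ℚ) [V.IsElliptic]
    [V.IsGloballyMinimal] (hV : Mult V p) {N : ℕ} [NeZero N] {g : CuspForm (Gamma0 N) 2}
    (hg : IsNewformOf V g) (i : ℕ) {m : ℕ} (hm : cyclotomicExponent p ≤ m + 1)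
    (κ : DirichletCharacter ℂ_[p] (p ^ (m + 1))) (heven : κ.Even) (hord : ∃ j : ℕ, orderOf κ = p ^ j) :
    HasSum (fun k : ℕ ↦ algebraMap ℚ_[p] ℂ_[p]
          (PowerSeries.coeff k (padicLFunctionPlusBranchMult g ((V.LFunction p : ℤ) : ℚ_[p]) i)) *
        (κ (cyclotomicGenerator p : ZMod (p ^ (m + 1))) - 1) ^ k)
      (algebraMap ℚ_[p] ℂ_[p] (((V.LFunction p : ℤ) : ℚ_[p])⁻¹ ^ (m + 1)) *
        ∑ a : ZMod (p ^ (m + 1)), κ a *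
          algebraMap ℚ_[p] ℂ_[p] (teichWeight p i (ZMod.castHom (pow_dvd_pow p hm)
            (ZMod (p ^ cyclotomicExponent p)) a)) *
          (ratPlusSymbol g ((a.val : ℚ) / ((p ^ (m + 1) : ℕ) : ℚ)) : ℂ_[p])) := by
  obtain ⟨hdist, C, hC⟩ := msdPlusMeasureMult_package_of_mult V hV hg
  simp only [coeff_padicLFunctionPlusBranchMult]
  exact hasSum_padicLPlusBranchMultCoeff_mul_pow g _ hdist hC i hm κ heven hord

/-- **Interpolation of the minus branch of a multiplicative newform at EVERY character of `Γ`.**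
[cite: MazurTateTeitelbaum1986Invent, §I.13–I.14] -/
theorem hasSum_coeff_padicLFunctionMinusBranchMult_mul_pow_of_mult (V : WeierstrassCurve ℚ) [V.IsElliptic]
    [V.IsGloballyMinimal] (hV : Mult V p) {N : ℕ} [NeZero N] {g : CuspForm (Gamma0 N) 2}
    (hg : IsNewformOf V g) (i : ℕ) {m : ℕ} (hm : cyclotomicExponent p ≤ m + 1)
    (κ : DirichletCharacter ℂ_[p] (p ^ (m + 1))) (heven : κ.Even) (hord : ∃ j : ℕ, orderOf κ = p ^ j) :
    HasSum (fun k : ℕ ↦ algebraMap ℚ_[p] ℂ_[p]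
          (PowerSeries.coeff k (padicLFunctionMinusBranchMult g ((V.LFunction p : ℤ) : ℚ_[p]) i)) *
        (κ (cyclotomicGenerator p : ZMod (p ^ (m + 1))) - 1) ^ k)
      (algebraMap ℚ_[p] ℂ_[p] (((V.LFunction p : ℤ) : ℚ_[p])⁻¹ ^ (m + 1)) *
        ∑ a : ZMod (p ^ (m + 1)), κ a *
          algebraMap ℚ_[p] ℂ_[p] (teichWeight p i (ZMod.castHom (pow_dvd_pow p hm)
            (ZMod (p ^ cyclotomicExponent p)) a)) *
          (ratMinusSymbol g ((a.val : ℚ) / ((p ^ (m + 1) : ℕ) : ℚ)) : ℂ_[p])) := by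
  obtain ⟨hdist, C, hC⟩ := msdMinusMeasureMult_package_of_mult V hV hg
  simp only [coeff_padicLFunctionMinusBranchMult]
  exact hasSum_padicLMinusBranchMultCoeff_mul_pow g _ hdist hC i hm κ heven hord

/-- **`L⁺_p(g, a_p, ω^{(p−1)/2}, 0) = a_p⁻¹ · ∑_{a mod p}(a/p)[a/p]⁺_g`** for the newform of a multiplicative
curve. [cite: MazurTateTeitelbaum1986Invent, §I.13–I.14 (constant term, ε(p) = 0)] -/
theorem constantCoeff_padicLFunctionPlusBranchMult_half_of_mult (hp2 : p ≠ 2) (V : WeierstrassCurve ℚ)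
    [V.IsElliptic] [V.IsGloballyMinimal] (hV : Mult V p) {N : ℕ} [NeZero N] {g : CuspForm (Gamma0 N) 2}
    (hg : IsNewformOf V g) :
    PowerSeries.constantCoeff (padicLFunctionPlusBranchMult g ((V.LFunction p : ℤ) : ℚ_[p]) (p / 2)) =
      (((V.LFunction p : ℤ) : ℚ_[p]))⁻¹ * (legendrePlusSymbolSum g p : ℚ_[p]) := by
  obtain ⟨-, hpN, -, hα0⟩ := multRoot_spec V hV hg
  exact constantCoeff_padicLFunctionPlusBranchMult_half p hp2 hg.1 hg.coeffField_eq_bot hpN (hg.2 p) hα0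

/-- **`L⁻_p(g, a_p, ω^{(p−1)/2}, 0) = a_p⁻¹ · ∑_{a mod p}(a/p)[a/p]⁻_g`** for the newform of a multiplicative
curve. [cite: MazurTateTeitelbaum1986Invent, §I.13–I.14 (constant term, ε(p) = 0)] -/
theorem constantCoeff_padicLFunctionMinusBranchMult_half_of_mult (hp2 : p ≠ 2) (V : WeierstrassCurve ℚ)
    [V.IsElliptic] [V.IsGloballyMinimal] (hV : Mult V p) {N : ℕ} [NeZero N] {g : CuspForm (Gamma0 N) 2}
    (hg : IsNewformOf V g) :
    PowerSeries.constantCoeff (padicLFunctionMinusBranchMult g ((V.LFunction p : ℤ) : ℚ_[p]) (p / 2)) =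
      (((V.LFunction p : ℤ) : ℚ_[p]))⁻¹ * (legendreMinusSymbolSum g p : ℚ_[p]) := by
  obtain ⟨-, hpN, -, hα0⟩ := multRoot_spec V hV hg
  exact constantCoeff_padicLFunctionMinusBranchMult_half p hp2 hg.1 hg.coeffField_eq_bot hpN (hg.2 p) hα0

/-- **The level-`p` sum against the trivial character is the Legendre symbol sum** (plus symbols):
`∑_{b mod p} 𝟙(b)·ω(b)^{(p−1)/2}·[b/p]⁺_g = ∑_{a mod p}(a/p)[a/p]⁺_g` (non-units contribute `0`; Euler's
criterion `teichWeight_half_castHom`). The α-free half of gz's `branchValue_one_eq_constantCoeff`.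
[cite: MazurTateTeitelbaum1986Invent, §I.8 (8.6), §I.13] -/
theorem sum_one_mul_teichWeight_mul_ratPlusSymbol_eq (hp2 : p ≠ 2) (hm : cyclotomicExponent p ≤ 0 + 1)
    {N : ℕ} (g : CuspForm (Gamma0 N) 2) :
    ∑ b : ZMod (p ^ (0 + 1)),
        (1 : DirichletCharacter ℂ_[p] (p ^ (0 + 1))) b *
          algebraMap ℚ_[p] ℂ_[p] (teichWeight p (p / 2)
            (ZMod.castHom (pow_dvd_pow p hm) (ZMod (p ^ cyclotomicExponent p)) b)) *
          (ratPlusSymbol g ((b.val : ℚ) / ((p ^ (0 + 1) : ℕ) : ℚ)) : ℂ_[p]) =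
      algebraMap ℚ_[p] ℂ_[p] (legendrePlusSymbolSum g p : ℚ_[p]) := by
  have hpP : p.Prime := hp.out
  have hp1 : ((p ^ (0 + 1) : ℕ) : ℚ) = (p : ℚ) := by rw [zero_add, pow_one]
  have hsummand : ∀ b : ZMod (p ^ (0 + 1)),
      (1 : DirichletCharacter ℂ_[p] (p ^ (0 + 1))) b *
          algebraMap ℚ_[p] ℂ_[p] (teichWeight p (p / 2)
            (ZMod.castHom (pow_dvd_pow p hm) (ZMod (p ^ cyclotomicExponent p)) b)) *
          (ratPlusSymbol g ((b.val : ℚ) / ((p ^ (0 + 1) : ℕ) : ℚ)) : ℂ_[p]) =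
        algebraMap ℚ_[p] ℂ_[p] (((legendreSym p (b.val : ℤ) : ℚ) *
          ratPlusSymbol g ((b.val : ℚ) / p) : ℚ) : ℚ_[p]) := by
    intro b
    rw [teichWeight_half_castHom p hp2 hm b, hp1]
    by_cases hb : IsUnit b
    · rw [MulChar.one_apply hb, one_mul]
      push_cast
      simp only [map_intCast]
    · have hcop : ¬ Nat.Coprime b.val (p ^ (0 + 1)) := by
        intro h; apply hb
        have hu := (ZMod.isUnit_iff_coprime b.val (p ^ (0 + 1))).mpr h
        rwa [ZMod.natCast_zmod_val] at hu
      have hdvdN : p ∣ b.val := by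
        by_contra hnd
        exact hcop (Nat.Coprime.pow_right _ ((Nat.Prime.coprime_iff_not_dvd hpP).mpr hnd).symm)
      have hz : ((b.val : ℤ) : ZMod p) = 0 :=
        (ZMod.intCast_zmod_eq_zero_iff_dvd _ p).mpr (by exact_mod_cast hdvdN)
      have h0 : legendreSym p (b.val : ℤ) = 0 := (legendreSym.eq_zero_iff p _).mpr hz
      rw [MulChar.map_nonunit _ hb, h0]
      simp
  rw [Finset.sum_congr rfl fun b _ ↦ hsummand b, legendrePlusSymbolSum]
  push_cast
  have hpe : p ^ (0 + 1) = p := by rw [zero_add, pow_one]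
  refine Fintype.sum_equiv (ZMod.ringEquivCongr hpe).toEquiv _ _ fun b ↦ ?_
  rw [RingEquiv.toEquiv_eq_coe, EquivLike.coe_coe, ZMod.ringEquivCongr_val]

/-- The minus twin: `∑_{b mod p} 𝟙(b)·ω(b)^{(p−1)/2}·[b/p]⁻_g = ∑_{a mod p}(a/p)[a/p]⁻_g`.
[cite: MazurTateTeitelbaum1986Invent, §I.8 (8.6), §I.13] -/
theorem sum_one_mul_teichWeight_mul_ratMinusSymbol_eq (hp2 : p ≠ 2) (hm : cyclotomicExponent p ≤ 0 + 1)
    {N : ℕ} (g : CuspForm (Gamma0 N) 2) :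
    ∑ b : ZMod (p ^ (0 + 1)),
        (1 : DirichletCharacter ℂ_[p] (p ^ (0 + 1))) b *
          algebraMap ℚ_[p] ℂ_[p] (teichWeight p (p / 2)
            (ZMod.castHom (pow_dvd_pow p hm) (ZMod (p ^ cyclotomicExponent p)) b)) *
          (ratMinusSymbol g ((b.val : ℚ) / ((p ^ (0 + 1) : ℕ) : ℚ)) : ℂ_[p]) =
      algebraMap ℚ_[p] ℂ_[p] (legendreMinusSymbolSum g p : ℚ_[p]) := by
  have hpP : p.Prime := hp.out
  have hp1 : ((p ^ (0 + 1) : ℕ) : ℚ) = (p : ℚ) := by rw [zero_add, pow_one]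
  have hsummand : ∀ b : ZMod (p ^ (0 + 1)),
      (1 : DirichletCharacter ℂ_[p] (p ^ (0 + 1))) b *
          algebraMap ℚ_[p] ℂ_[p] (teichWeight p (p / 2)
            (ZMod.castHom (pow_dvd_pow p hm) (ZMod (p ^ cyclotomicExponent p)) b)) *
          (ratMinusSymbol g ((b.val : ℚ) / ((p ^ (0 + 1) : ℕ) : ℚ)) : ℂ_[p]) =
        algebraMap ℚ_[p] ℂ_[p] (((legendreSym p (b.val : ℤ) : ℚ) *
          ratMinusSymbol g ((b.val : ℚ) / p) : ℚ) : ℚ_[p]) := by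
    intro b
    rw [teichWeight_half_castHom p hp2 hm b, hp1]
    by_cases hb : IsUnit b
    · rw [MulChar.one_apply hb, one_mul]
      push_cast
      simp only [map_intCast]
    · have hcop : ¬ Nat.Coprime b.val (p ^ (0 + 1)) := by
        intro h; apply hb
        have hu := (ZMod.isUnit_iff_coprime b.val (p ^ (0 + 1))).mpr h
        rwa [ZMod.natCast_zmod_val] at hu
      have hdvdN : p ∣ b.val := by
        by_contra hnd
        exact hcop (Nat.Coprime.pow_right _ ((Nat.Prime.coprime_iff_not_dvd hpP).mpr hnd).symm)
      have hz : ((b.val : ℤ) : ZMod p) = 0 :=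
        (ZMod.intCast_zmod_eq_zero_iff_dvd _ p).mpr (by exact_mod_cast hdvdN)
      have h0 : legendreSym p (b.val : ℤ) = 0 := (legendreSym.eq_zero_iff p _).mpr hz
      rw [MulChar.map_nonunit _ hb, h0]
      simp
  rw [Finset.sum_congr rfl fun b _ ↦ hsummand b, legendreMinusSymbolSum]
  push_cast
  have hpe : p ^ (0 + 1) = p := by rw [zero_add, pow_one]
  refine Fintype.sum_equiv (ZMod.ringEquivCongr hpe).toEquiv _ _ fun b ↦ ?_
  rw [RingEquiv.toEquiv_eq_coe, EquivLike.coe_coe, ZMod.ringEquivCongr_val]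

end Package

end Summit.BirchSwinnertonDyer.BirchSwinnertonDyer.Theorems.AdditiveBranchIMCMultLower

end
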